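import Literature.Geometry.Riemannian.ThreeShrinkerDegenerateFibre
import Literature.Geometry.Riemannian.ThreeShrinkerDegenerateRound
import HarnessLib

/-!
# Degenerate three-dimensional shrinkers: the model data

Assembly of the degenerate case of Munteanu–Wang 2016, Thm. 1.2 (the cylinder `S²×ℝ` and its
`ℤ₂`-quotient), in the language of `threeShrinkerClassification_modelData`: a complete connected
normalised (`Ric + Hess f = ½ g`, `S + |∇f|² = f`) three-dimensional gradient shrinking Ricci
soliton with `Ric ≥ 0`, `S > 0` and a null vector of `Ric` at some point has `S ≡ 1` and weighted
volume `∫_M e^{−f} dV ∈ {16π√π/e, 8π√π/e}`: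

* `S ≡ 1` is `DegenerateShrinker.scalarCurvature_eq_one_of_degenerate` (`…DegenerateRound`);
* a critical point `p` of `f` with `f(p) = S(p) = 1` exists (`exists_critical_min_max`);
* the developing map `Φ : (ℝ³ ∖ 0, 2|y|⁻²δ) → M` through `p` (`exists_isDeveloping`) is a
  Riemannian covering with fibres of cardinality `k ∈ {1, 2}` and
  `∫_C e^{−f_C} = k ∫_M e^{−f}`, `∫_C e^{−f_C} = 16π√π/e` (`IsDeveloping.lintegral_exp_neg_f`).

Everything is proved (D-0026: no new facts).

## References

* O. Munteanu, J. Wang, *Structure at infinity for shrinking Ricci solitons*, arXiv:1606.01861,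
  Thm. 1.2 (p. 3). [MunteanuWang2016]
* R. S. Hamilton, *The Ricci flow on surfaces*, Contemp. Math. 71 (1988), §10. [Hamilton1988]
-/

noncomputable section

open Bundle Set Function Filter Module Metric MeasureTheory
open scoped Manifold ContDiff Topology NNReal ENNReal

namespace Literature.Geometry.Riemannian

open Lorentzian Lorentzian.PseudoRiemannianMetric RoundCylinderThree

namespace DegenerateShrinker

variable {M : Type*} [TopologicalSpace M] [ChartedSpace (EuclideanSpace ℝ (Fin 3)) M]
  [IsManifold (𝓡 3) ∞ M]
  (g : PseudoRiemannianMetric (𝓡 3) ∞ (EuclideanSpace ℝ (Fin 3)) (TangentSpace (𝓡 3) : M → Type _))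
  [g.HasLeviCivita]

/-- **The degenerate case of the classification of three-dimensional shrinkers** (Munteanu–Wang
2016, Thm. 1.2, cylinder branch): `S ≡ 1` and `∫_M e^{−f} dV = 16π√π/e` (the cylinder
`S²(√2) × ℝ`) or `8π√π/e` (its `ℤ₂`-quotient). [cite: MunteanuWang2016, Thm. 1.2 (p. 3)] -/
theorem modelData_of_degenerate [T2Space M] [ConnectedSpace M] [T3Space M]
    [SecondCountableTopology M] [MeasurableSpace M] [BorelSpace M] (hg : g.IsRiemannian)
    {f : M → ℝ} (hf : ContMDiff (𝓡 3) 𝓘(ℝ, ℝ) ∞ f)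
    (hsol : ∀ (x : M) (X Y : TangentSpace (𝓡 3) x),
      g.ricci x X Y + g.hessian f x X Y = (1 / 2 : ℝ) * g.val x X Y)
    (hnorm : ∀ x : M, g.scalarCurvature x + g.gradSq f x = f x)
    (hcpl : ∀ (x : M) (r : ℝ≥0), IsCompact {y : M | g.edist hg x y ≤ r})
    (hRic0 : ∀ (x : M) (w : TangentSpace (𝓡 3) x), 0 ≤ g.ricci x w w)
    (hS : ∀ x, 0 < g.scalarCurvature x) {p₀ : M} {w₀ : TangentSpace (𝓡 3) p₀} (hw₀ : w₀ ≠ 0)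
    (hnull : g.ricci p₀ w₀ w₀ = 0) :
    ((∀ x, g.scalarCurvature x = 1) ∧
      ∫⁻ x, ENNReal.ofReal (Real.exp (-f x)) ∂(riemannianMeasure (g.toContMDiffRiemannianMetric hg)) =
        ENNReal.ofReal (16 * Real.pi * Real.sqrt Real.pi * Real.exp (-1))) ∨
    ((∀ x, g.scalarCurvature x = 1) ∧
      ∫⁻ x, ENNReal.ofReal (Real.exp (-f x)) ∂(riemannianMeasure (g.toContMDiffRiemannianMetric hg)) =
        ENNReal.ofReal (8 * Real.pi * Real.sqrt Real.pi * Real.exp (-1))) := by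
  -- `S ≡ 1`
  have hS1 : ∀ x, g.scalarCurvature x = 1 := fun x ↦
    (scalarCurvature_eq_one_of_degenerate g hg hf hsol hnorm hcpl hRic0 hS hw₀ hnull x).1
  -- completeness
  have hc : IsGeodesicallyComplete g.leviCivita :=
    HadamardExpCovering.isGeodesicallyComplete_of_isCompact_setOf_edist_le (g := g) hg hcpl
  -- a critical point of `f` with `f = 1`
  obtain ⟨-, -, -, p, -, ⟨-, -, hgrad, hfS, -⟩, -⟩ := exists_critical_min_max g hg hf hsol hRic0 hS hw₀ hnull
    (gradf := fun x ↦ g.sharp x (mvfderiv (𝓡 3) f x : TangentSpace (𝓡 3) x →ₗ[ℝ] ℝ))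
    (fun _ ↦ rfl)
    (H := fun x ↦ g.gradSq f x - 2 / g.scalarCurvature x *
      g.ricci x (g.sharp x (mvfderiv (𝓡 3) f x : TangentSpace (𝓡 3) x →ₗ[ℝ] ℝ))
        (g.sharp x (mvfderiv (𝓡 3) f x : TangentSpace (𝓡 3) x →ₗ[ℝ] ℝ)))
    (fun _ ↦ rfl)
    (κ := fun x w ↦ g.val x w w - 2 / g.scalarCurvature x * g.ricci x w w) (fun _ _ ↦ rfl)
    (σ := fun x w ↦ mvfderiv (𝓡 3) f x w - 2 / g.scalarCurvature x *
      g.ricci x (g.sharp x (mvfderiv (𝓡 3) f x : TangentSpace (𝓡 3) x →ₗ[ℝ] ℝ)) w)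
    (fun _ _ ↦ rfl) rfl hnorm hcpl
  have hfp : f p = 1 := by rw [hfS, hS1]
  -- the developing map and the weighted volume
  obtain ⟨Φ, hdev, -⟩ := exists_isDeveloping g hg hf hsol hRic0 hS hw₀ hnull
    (κ := fun x w ↦ g.val x w w - 2 / g.scalarCurvature x * g.ricci x w w) (fun _ _ ↦ rfl) rfl hS1 hc
    hnorm hfp
  rcases hdev.lintegral_exp_neg_f hg hf hsol hRic0 hS hw₀ hnull
      (κ := fun x w ↦ g.val x w w - 2 / g.scalarCurvature x * g.ricci x w w) (fun _ _ ↦ rfl) hc with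
    h | h
  · exact Or.inl ⟨hS1, h⟩
  · exact Or.inr ⟨hS1, h⟩

end DegenerateShrinker

end Literature.Geometry.Riemannian

end
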